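import Literature.NumberTheory.GaloisRepresentations.DiscreteValuationDivisibleUnits
import Literature.NumberTheory.EllipticCurves.PAdicLFunctionInterpolationProofs
import Mathlib.NumberTheory.Padics.Complex
import Mathlib.RingTheory.PowerSeries.Evaluation
import HarnessLib

/-!
# `p`-power roots of unity are principal units in ANY ultrametric normed field with `‖p‖ < 1`, and the
# points `εw − 1` of Mathlib's `ℂ_[p]` at which Coleman series are evaluated

Topic `NumberTheory/GaloisRepresentations`; namespace `Literature.NumberTheory.GaloisRepresentations`. Cell
`bsd-print-cf2` (HOME `run/shared/lean/pub/bsd-print-cf2/`), seat `bsd-line-cf2-p1-w7` g7; companion of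
`PAdicHodge/UnramifiedCompletionToPadicComplex.lean` (GAP-2: `𝐃 → ℂ_[p]`) and of `LubinTateRootsOfUnityTorsion.lean`
(the same statements for the tree's `ℂ_F`). Once a series `H ∈ 𝐃⟦S⟧` is read in Mathlib's `ℂ_[p]` (so that the
measure-side criterion `PAdicOneVariableTraceCriterion*.lean`, generic over normed `ℚ_[p]`-algebras, applies), its
values at the points `εw − 1` (`ε` a `p`-power root of unity, `w^p = 1`) are the convergent sums
`Σ' m, [S^m]H (εw − 1)^m` — Mathlib's `PowerSeries.aeval`/`PowerSeries.hasSum_aeval` at a topologically nilpotent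
point. This file supplies the nilpotence:

* **`norm_sub_one_lt_one_of_norm_natCast_lt_one`** — in any ultrametric normed field `K` with `‖p‖ < 1`, a
  `p`-power root of unity `ζ` has `‖ζ − 1‖ < 1` (the tree's `valuation_sub_one_lt_one_of_pow_prime_pow` for the norm
  valuation; de Shalit I §3.3's points `ς(1+S) − 1`);
* (with the tree's `norm_prime_padicComplex_lt_one`) **`PadicComplex.norm_sub_one_lt_one_of_pow_prime_pow_eq_one`**,
  `PadicComplex.norm_mul_sub_one_lt_one` (`‖εw − 1‖ < 1` for two `p`-power roots of unity),
  **`PadicComplex.hasEval_mul_sub_one`** (`εw − 1` is topologically nilpotent: `PowerSeries.HasEval`; NOTE: a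
  field is not linearly topologised, so `PowerSeries.aeval` itself is taken in the unit ball `LubinTate.unitBall ℂ_[p]`
  — complete and linearly topologised, tree instances — exactly as the tree does in `𝒪_{ℂ_F}`; the values in
  `ℂ_[p]` are then the tsums `Σ' m, [S^m]H · y^m` of `LubinTate.hasSum_coeff_smul_pow_evalPt₁` pushed along the
  inclusion).

No definition, no named fact, no `sorry`. HONEST FRAMING: analytic plumbing for brick (d) of the (Q)-socket;
BSD is not advanced by this file.

## References
* [deShalit1987] E. de Shalit, *Iwasawa theory of elliptic curves with complex multiplication* (1987), I §3.3
  (7)–(7′) (the points `ς(1+S) − 1`), I §3.6 (12).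
* [SerreLocalFields1979] J.-P. Serre, *Local Fields*, Ch. IV §4 Prop. 17 (`v(ζ − 1)` for `p`-power roots of unity).
-/

noncomputable section

open Filter Topology

namespace Literature.NumberTheory.GaloisRepresentations

/-! ### Any ultrametric normed field with `‖p‖ < 1` -/

section Ultrametric

variable {K : Type*} [NormedField K] [IsUltrametricDist K] {p : ℕ} [hp : Fact p.Prime]

/-- **`p`-power roots of unity are principal units**: if `‖p‖ < 1` in the ultrametric normed field `K` and
`ζ^{p^n} = 1`, then `‖ζ − 1‖ < 1` (`(ζ − 1)^{p^n} ≡ ζ^{p^n} − 1 (mod p)`; the tree's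
`valuation_sub_one_lt_one_of_pow_prime_pow` for the norm valuation `NormedField.valuation`).
[cite: SerreLocalFields1979, Ch. IV §4 Prop. 17] -/
theorem norm_sub_one_lt_one_of_norm_natCast_lt_one (hpK : ‖(p : K)‖ < 1) {ζ : K} (n : ℕ)
    (hζ : ζ ^ p ^ n = 1) : ‖ζ - 1‖ < 1 := by
  have hk : p ^ n ≠ 0 := pow_ne_zero n hp.out.ne_zero
  have hζ1 : ‖ζ‖ ≤ 1 := by
    have h1 : ‖ζ‖ ^ (p ^ n) = 1 := by rw [← norm_pow, hζ, norm_one]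
    exact ((pow_eq_one_iff_of_nonneg (norm_nonneg ζ) hk).mp h1).le
  have key := valuation_sub_one_lt_one_of_pow_prime_pow (NormedField.valuation (K := K)) (p := p) (u := ζ)
    ?_ ?_ n ?_
  · rw [NormedField.valuation_apply, ← NNReal.coe_lt_coe, coe_nnnorm, NNReal.coe_one] at key
    exact key
  · rw [NormedField.valuation_apply, ← NNReal.coe_lt_coe, coe_nnnorm, NNReal.coe_one]
    exact hpK
  · rw [NormedField.valuation_apply, ← NNReal.coe_le_coe, coe_nnnorm, NNReal.coe_one]
    exact hζ1
  · rw [hζ, sub_self, map_zero]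
    exact zero_lt_one

omit [IsUltrametricDist K] in
/-- A `p`-power root of unity has norm `1`. [cite: SerreLocalFields1979, Ch. IV §4 Prop. 17] -/
theorem norm_eq_one_of_pow_prime_pow_eq_one {ζ : K} (n : ℕ) (hζ : ζ ^ p ^ n = 1) : ‖ζ‖ = 1 := by
  have hk : p ^ n ≠ 0 := pow_ne_zero n hp.out.ne_zero
  have h1 : ‖ζ‖ ^ (p ^ n) = 1 := by rw [← norm_pow, hζ, norm_one]
  exact (pow_eq_one_iff_of_nonneg (norm_nonneg ζ) hk).mp h1

/-- **`‖εw − 1‖ < 1`** for two `p`-power roots of unity `ε`, `w` (`εw − 1 = ε(w − 1) + (ε − 1)`, ultrametric).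
[cite: deShalit1987, I §3.3 (7)–(7′)] -/
theorem norm_mul_sub_one_lt_one_of_pow_prime_pow_eq_one (hpK : ‖(p : K)‖ < 1) {ε w : K} (n m : ℕ)
    (hε : ε ^ p ^ n = 1) (hw : w ^ p ^ m = 1) : ‖ε * w - 1‖ < 1 := by
  have h1 : ε * w - 1 = ε * (w - 1) + (ε - 1) := by ring
  rw [h1]
  refine (IsUltrametricDist.norm_add_le_max _ _).trans_lt (max_lt ?_ ?_)
  · rw [norm_mul, norm_eq_one_of_pow_prime_pow_eq_one n hε, one_mul]
    exact norm_sub_one_lt_one_of_norm_natCast_lt_one hpK m hw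
  · exact norm_sub_one_lt_one_of_norm_natCast_lt_one hpK n hε

omit [IsUltrametricDist K] in
/-- An element of norm `< 1` of a normed ring is topologically nilpotent, i.e. a point of evaluation of power
series (Mathlib `PowerSeries.HasEval`). [cite: deShalit1987, I §3.3 (7)–(7′)] -/
theorem hasEval_of_norm_lt_one {y : K} (hy : ‖y‖ < 1) : PowerSeries.HasEval y :=
  tendsto_pow_atTop_nhds_zero_of_norm_lt_one hy

end Ultrametric

/-! ### Mathlib's `ℂ_[p]` -/

section PadicComplex

variable {p : ℕ} [hp : Fact p.Prime]

/-- **A `p`-power root of unity `ζ ∈ ℂ_[p]` has `‖ζ − 1‖ < 1`.** [cite: SerreLocalFields1979, Ch. IV §4 Prop. 17] -/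
theorem PadicComplex.norm_sub_one_lt_one_of_pow_prime_pow_eq_one {ζ : ℂ_[p]} (n : ℕ) (hζ : ζ ^ p ^ n = 1) :
    ‖ζ - 1‖ < 1 :=
  norm_sub_one_lt_one_of_norm_natCast_lt_one (Literature.NumberTheory.EllipticCurves.norm_prime_padicComplex_lt_one (p := p)) n hζ

/-- **`‖εw − 1‖ < 1` in `ℂ_[p]`** for `p`-power roots of unity `ε`, `w` — the points of de Shalit's I §3.3 (7).
[cite: deShalit1987, I §3.3 (7)–(7′)] -/
theorem PadicComplex.norm_mul_sub_one_lt_one {ε w : ℂ_[p]} (n m : ℕ) (hε : ε ^ p ^ n = 1) (hw : w ^ p ^ m = 1) :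
    ‖ε * w - 1‖ < 1 :=
  norm_mul_sub_one_lt_one_of_pow_prime_pow_eq_one (Literature.NumberTheory.EllipticCurves.norm_prime_padicComplex_lt_one (p := p)) n m hε hw

/-- **`εw − 1` is a point of evaluation** (`PowerSeries.HasEval`) for `p`-power roots of unity `ε`, `w ∈ ℂ_[p]`.
[cite: deShalit1987, I §3.3 (7)–(7′)] -/
theorem PadicComplex.hasEval_mul_sub_one {ε w : ℂ_[p]} (n m : ℕ) (hε : ε ^ p ^ n = 1) (hw : w ^ p ^ m = 1) :
    PowerSeries.HasEval (ε * w - 1) :=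
  hasEval_of_norm_lt_one (PadicComplex.norm_mul_sub_one_lt_one n m hε hw)

end PadicComplex

end Literature.NumberTheory.GaloisRepresentations

end
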